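import Mathlib
import HarnessLib
import Literature.Combinatorics.SimpleGraph.LasserreStableBound
import Summits.PneNP.PneNP.Theses.RamseyUncertifiable
import Summits.PneNP.PneNP.Theorems.RamseyUncertifiableSosUncertaintyGraphOperations

/-!
# Route `RamseyUncertifiable`, item `SosUncertainty` (stmt-PneNP-9815) — Lasserre's bound of a join
# is the maximum of the parts, I: quadratic forms and the scaled restrictions

(The assembly of the theorem is in `RamseyUncertifiableSosUncertaintyJoin.lean`; this file carries the
quadratic-form lemmas it needs.) Companion of `RamseyUncertifiableSosUncertaintyGraphOperations.lean` (where `las_t` is shown ADDITIVE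
over disjoint unions and the join is shown to DOMINATE its parts). Here the reverse inequality:

* `lasserreStableBound_le_max_of_forall_adj` — if every vertex of the `V`-side of a graph `P` on
  `V ⊕ W` is adjacent to every vertex of the `W`-side (a JOIN), then
  `las_t(P) ≤ max (las_t(P.comap inl)) (las_t(P.comap inr))` (`t ≥ 1`);
* `lasserreStableBound_compl_sum` — hence `las_t((G ⊕g H)ᶜ) = max (las_t Gᶜ) (las_t Hᶜ)`, and with
  additivity the EXACT uncertainty product of a disjoint union,
  `uncertaintyProduct_sum_eq`: `f_t(G ⊕g H) = (las_t G + las_t H) · max (las_t Gᶜ) (las_t Hᶜ)`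
  (e.g. `f₂(m·C₅) = 2m · 2 = 4n/5`, the refuter's "Lovász shape fails for every `n₀`").

Proof of the inequality (the "`p`-trick", a scaled restriction). Let `y` be level-`t` feasible for
the join `P`. Every set meeting both sides is non-stable, so `y` vanishes on it (up to size `2t`), and
the principal submatrix of `M_t(y)` on `∅`, the nonempty left sets and the nonempty right sets is
`[[1, aᵀ, bᵀ], [a, A, 0], [b, 0, B]] ⪰ 0`. In quadratic-form language
(`join_quadForm_nonneg`): `c² + 2c(ℓ_L + ℓ_R) + q_L + q_R ≥ 0` for all test data, where `ℓ, q` are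
the linear and quadratic parts on each side. Put `p := sup ℓ_L²/q_L`, `p' := sup ℓ_R²/q_R` (over test
vectors with `q > 0`); then `p + p' ≤ 1` (`ratio_add_ratio_le_one`), and `S ↦ y(S)/p` (with `∅ ↦ 1`)
is level-`t` feasible for the left part (`isLasserreFeasible_scaledRestrict`: its moment matrix is
`[[1, aᵀ/p], [a/p, A/p]]`, positive semidefinite exactly because `ℓ_L² ≤ p q_L`). So the left
singletons sum to `≤ p · las_t(left)`, the right ones to `≤ p' · las_t(right)`, total `≤ max`.
[folklore; for `t = 1` (`ϑ` of a join = max) Lovász 1979 / Knuth 1994 §20]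
-/

-- the Theorems namespace `Summit.PneNP.PneNP.Theorems` is prescribed by the tree layout
set_option linter.dupNamespace false

namespace Summit.PneNP.PneNP.Theorems.SosUncertainty

open Literature.Combinatorics.SimpleGraph Finset Matrix

/-! ### Quadratic forms as double sums -/

section QuadForm

variable {ι : Type} [Fintype ι]

/-- `xᵀ N x = Σ_{i,j} x_i N_{ij} x_j`. [folklore] -/
theorem quadForm_eq_sum (N : Matrix ι ι ℝ) (x : ι → ℝ) :
    x ⬝ᵥ (N *ᵥ x) = ∑ i, ∑ j, x i * N i j * x j := by
  simp only [dotProduct, mulVec, Finset.mul_sum]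
  exact sum_congr rfl fun i _ => sum_congr rfl fun j _ => by ring

end QuadForm

section Join

variable {V W : Type} [Fintype V] [DecidableEq V] [Fintype W] [DecidableEq W]
variable {P : SimpleGraph (V ⊕ W)} {t : ℕ} {y : Finset (V ⊕ W) → ℝ}

/-- In a join, a feasible moment vector vanishes on every set meeting both sides (of size `≤ 2t`).
[folklore] -/
theorem apply_map_inl_union_map_inr_eq_zero (hP : ∀ v w, P.Adj (Sum.inl v) (Sum.inr w))
    (hy : IsLasserreFeasible P t y) {S : Finset V} {T : Finset W} (hS : S ≠ ∅) (hT : T ≠ ∅)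
    (hc : S.card + T.card ≤ 2 * t) :
    y (S.map Function.Embedding.inl ∪ T.map Function.Embedding.inr) = 0 := by
  obtain ⟨v, hv⟩ := nonempty_iff_ne_empty.2 hS
  obtain ⟨w, hw⟩ := nonempty_iff_ne_empty.2 hT
  apply hy.apply_eq_zero_of_not_isIndepSet
  · exact (card_union_le _ _).trans (by rwa [card_map, card_map])
  · intro hind
    have h1 : (Sum.inl v : V ⊕ W) ∈ ((S.map Function.Embedding.inl ∪ T.map Function.Embedding.inr :
        Finset (V ⊕ W)) : Set (V ⊕ W)) := by simp [hv]
    have h2 : (Sum.inr w : V ⊕ W) ∈ ((S.map Function.Embedding.inl ∪ T.map Function.Embedding.inr :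
        Finset (V ⊕ W)) : Set (V ⊕ W)) := by simp [hw]
    exact hind h1 h2 (by simp) (hP v w)

/-- **The joint quadratic inequality of a join.** For `y` level-`t` feasible for a join `P` on
`V ⊕ W`, all `c : ℝ` and all test vectors `zL`, `zR` on the nonempty sets of size `≤ t` of each side:
`0 ≤ c² + 2c(ℓ_L + ℓ_R) + q_L + q_R`, where `ℓ_L = Σ_S zL_S y(S)`, `q_L = Σ_{S,S'} zL_S y(S ∪ S') zL_S'`
(left sets embedded by `inl`) and similarly on the right — the quadratic form of `M_t(y)` at the test
vector `(c, zL, zR, 0)`, the cross block vanishing by `apply_map_inl_union_map_inr_eq_zero`.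
[folklore] -/
theorem join_quadForm_nonneg (hP : ∀ v w, P.Adj (Sum.inl v) (Sum.inr w))
    (hy : IsLasserreFeasible P t y) (c : ℝ)
    (zL : {S : Finset V // S ≠ ∅ ∧ S.card ≤ t} → ℝ) (zR : {T : Finset W // T ≠ ∅ ∧ T.card ≤ t} → ℝ) :
    0 ≤ c ^ 2 + 2 * c * ((∑ S, zL S * y (S.1.map Function.Embedding.inl)) +
        ∑ T, zR T * y (T.1.map Function.Embedding.inr)) +
      (∑ S, ∑ S', zL S * y ((S.1 ∪ S'.1).map Function.Embedding.inl) * zL S') +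
      ∑ T, ∑ T', zR T * y ((T.1 ∪ T'.1).map Function.Embedding.inr) * zR T' := by
  -- the index map into `P_t(V ⊕ W)`
  let e : Unit ⊕ ({S : Finset V // S ≠ ∅ ∧ S.card ≤ t} ⊕ {T : Finset W // T ≠ ∅ ∧ T.card ≤ t}) →
      {K : Finset (V ⊕ W) // K.card ≤ t} :=
    Sum.elim (fun _ => ⟨∅, by simp⟩)
      (Sum.elim (fun S => ⟨S.1.map Function.Embedding.inl, by rw [card_map]; exact S.2.2⟩)
        (fun T => ⟨T.1.map Function.Embedding.inr, by rw [card_map]; exact T.2.2⟩))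
  have h := (hy.posSemidef.submatrix e).dotProduct_mulVec_nonneg
    (Sum.elim (fun _ => c) (Sum.elim zL zR))
  rw [star_trivial, quadForm_eq_sum] at h
  -- the vanishing cross terms
  have hmix : ∀ (S : {S : Finset V // S ≠ ∅ ∧ S.card ≤ t}) (T : {T : Finset W // T ≠ ∅ ∧ T.card ≤ t}),
      y (S.1.map Function.Embedding.inl ∪ T.1.map Function.Embedding.inr) = 0 :=
    fun S T => apply_map_inl_union_map_inr_eq_zero hP hy S.2.1 T.2.1 (by have := S.2.2; have := T.2.2; omega)
  have hmix' : ∀ (S : {S : Finset V // S ≠ ∅ ∧ S.card ≤ t}) (T : {T : Finset W // T ≠ ∅ ∧ T.card ≤ t}),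
      y (T.1.map Function.Embedding.inr ∪ S.1.map Function.Embedding.inl) = 0 :=
    fun S T => by rw [union_comm]; exact hmix S T
  simp only [Fintype.sum_sum_type, Finset.univ_unique, Finset.sum_singleton, Sum.elim_inl,
    Sum.elim_inr, submatrix_apply, momentMatrix_apply, e, empty_union, union_empty,
    ← Finset.map_union, hmix, hmix', mul_zero, zero_mul, Finset.sum_const_zero, add_zero,
    zero_add, hy.empty_eq_one, mul_one] at h
  -- collect
  have h1 : ∑ x : {S : Finset V // S ≠ ∅ ∧ S.card ≤ t}, c * y (x.1.map Function.Embedding.inl) * zL x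
      = c * ∑ S, zL S * y (S.1.map Function.Embedding.inl) := by
    rw [Finset.mul_sum]; exact sum_congr rfl fun S _ => by ring
  have h2 : ∑ x : {T : Finset W // T ≠ ∅ ∧ T.card ≤ t}, c * y (x.1.map Function.Embedding.inr) * zR x
      = c * ∑ T, zR T * y (T.1.map Function.Embedding.inr) := by
    rw [Finset.mul_sum]; exact sum_congr rfl fun T _ => by ring
  have h3 : ∑ x : {S : Finset V // S ≠ ∅ ∧ S.card ≤ t},
      (zL x * y (x.1.map Function.Embedding.inl) * c +
        ∑ x' : {S : Finset V // S ≠ ∅ ∧ S.card ≤ t},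
          zL x * y ((x.1 ∪ x'.1).map Function.Embedding.inl) * zL x')
      = c * ∑ S, zL S * y (S.1.map Function.Embedding.inl) +
        ∑ S, ∑ S', zL S * y ((S.1 ∪ S'.1).map Function.Embedding.inl) * zL S' := by
    rw [Finset.sum_add_distrib, Finset.mul_sum]
    congr 1
    exact sum_congr rfl fun S _ => by ring
  have h4 : ∑ x : {T : Finset W // T ≠ ∅ ∧ T.card ≤ t},
      (zR x * y (x.1.map Function.Embedding.inr) * c +
        ∑ x' : {T : Finset W // T ≠ ∅ ∧ T.card ≤ t},
          zR x * y ((x.1 ∪ x'.1).map Function.Embedding.inr) * zR x')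
      = c * ∑ T, zR T * y (T.1.map Function.Embedding.inr) +
        ∑ T, ∑ T', zR T * y ((T.1 ∪ T'.1).map Function.Embedding.inr) * zR T' := by
    rw [Finset.sum_add_distrib, Finset.mul_sum]
    congr 1
    exact sum_congr rfl fun T _ => by ring
  rw [h1, h2, h3, h4] at h
  nlinarith [h]

/-- Consequences on one side: the quadratic part is nonnegative and dominates the square of the
linear part (`ℓ_L² ≤ q_L`). [folklore] -/
theorem lin_sq_le_quad_left (hP : ∀ v w, P.Adj (Sum.inl v) (Sum.inr w))
    (hy : IsLasserreFeasible P t y) (zL : {S : Finset V // S ≠ ∅ ∧ S.card ≤ t} → ℝ) :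
    (∑ S, zL S * y (S.1.map Function.Embedding.inl)) ^ 2 ≤
      ∑ S, ∑ S', zL S * y ((S.1 ∪ S'.1).map Function.Embedding.inl) * zL S' := by
  have h := join_quadForm_nonneg hP hy (-(∑ S, zL S * y (S.1.map Function.Embedding.inl))) zL
    (fun _ => 0)
  simp only [zero_mul, Finset.sum_const_zero, add_zero] at h
  nlinarith [h]

/-- The same on the right side. [folklore] -/
theorem lin_sq_le_quad_right (hP : ∀ v w, P.Adj (Sum.inl v) (Sum.inr w))
    (hy : IsLasserreFeasible P t y) (zR : {T : Finset W // T ≠ ∅ ∧ T.card ≤ t} → ℝ) :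
    (∑ T, zR T * y (T.1.map Function.Embedding.inr)) ^ 2 ≤
      ∑ T, ∑ T', zR T * y ((T.1 ∪ T'.1).map Function.Embedding.inr) * zR T' := by
  have h := join_quadForm_nonneg hP hy (-(∑ T, zR T * y (T.1.map Function.Embedding.inr)))
    (fun _ => 0) zR
  simp only [zero_mul, Finset.sum_const_zero, add_zero, zero_add] at h
  nlinarith [h]

/-- Scaling a test vector scales the linear part. [folklore] -/
theorem sum_smul_mul {ι : Type} [Fintype ι] (a : ℝ) (z f : ι → ℝ) :
    ∑ i, a * z i * f i = a * ∑ i, z i * f i := by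
  rw [Finset.mul_sum]; exact sum_congr rfl fun i _ => by ring

/-- Scaling a test vector scales the quadratic part by the square. [folklore] -/
theorem sum_sum_smul_mul_smul {ι : Type} [Fintype ι] (a : ℝ) (z : ι → ℝ) (g : ι → ι → ℝ) :
    ∑ i, ∑ j, a * z i * g i j * (a * z j) = a ^ 2 * ∑ i, ∑ j, z i * g i j * z j := by
  rw [Finset.mul_sum]
  refine sum_congr rfl fun i _ => ?_
  rw [Finset.mul_sum]
  exact sum_congr rfl fun j _ => by ring

/-- The joint inequality at scaled test vectors: `0 ≤ c² + 2c(aℓ_L + bℓ_R) + a²q_L + b²q_R`.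
[folklore] -/
theorem join_quadForm_nonneg_smul (hP : ∀ v w, P.Adj (Sum.inl v) (Sum.inr w))
    (hy : IsLasserreFeasible P t y) (a b c : ℝ)
    (zL : {S : Finset V // S ≠ ∅ ∧ S.card ≤ t} → ℝ) (zR : {T : Finset W // T ≠ ∅ ∧ T.card ≤ t} → ℝ) :
    0 ≤ c ^ 2 + 2 * c * (a * (∑ S, zL S * y (S.1.map Function.Embedding.inl)) +
        b * ∑ T, zR T * y (T.1.map Function.Embedding.inr)) +
      a ^ 2 * (∑ S, ∑ S', zL S * y ((S.1 ∪ S'.1).map Function.Embedding.inl) * zL S') +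
      b ^ 2 * ∑ T, ∑ T', zR T * y ((T.1 ∪ T'.1).map Function.Embedding.inr) * zR T' := by
  have h := join_quadForm_nonneg hP hy c (fun S => a * zL S) (fun T => b * zR T)
  rwa [sum_smul_mul, sum_smul_mul, sum_sum_smul_mul_smul, sum_sum_smul_mul_smul] at h

/-- **The two ratios sum to at most one** (pure algebra): if
`0 ≤ c² + 2c(aℓ + bℓ') + a²q + b²q'` for all `a b c` and `q, q' > 0`, then `ℓ²/q + ℓ'²/q' ≤ 1`
(test at `a = ℓ/q`, `b = ℓ'/q'`, `c = −(ρ + ρ')`). [folklore] -/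
theorem ratio_add_ratio_le_one {l q l' q' : ℝ} (hq : 0 < q) (hq' : 0 < q')
    (h : ∀ a b c : ℝ, 0 ≤ c ^ 2 + 2 * c * (a * l + b * l') + a ^ 2 * q + b ^ 2 * q') :
    l ^ 2 / q + l' ^ 2 / q' ≤ 1 := by
  set ρ := l ^ 2 / q with hρ
  set ρ' := l' ^ 2 / q' with hρ'
  have h1 := h (l / q) (l' / q') (-(ρ + ρ'))
  have e1 : l / q * l = ρ := by rw [hρ]; field_simp
  have e2 : (l / q) ^ 2 * q = ρ := by rw [hρ]; field_simp
  have e3 : l' / q' * l' = ρ' := by rw [hρ']; field_simp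
  have e4 : (l' / q') ^ 2 * q' = ρ' := by rw [hρ']; field_simp
  rw [e1, e2, e3, e4] at h1
  have hρ0 : 0 ≤ ρ := by rw [hρ]; positivity
  have hρ'0 : 0 ≤ ρ' := by rw [hρ']; positivity
  nlinarith [h1, hρ0, hρ'0]

/-- Registered form (sub-goal of stmt-PneNP-9815 for this file): in a join, the left quadratic
part dominates the square of the left linear part. [folklore] -/
theorem join_lin_sq_le_quad :
    ∀ {V W : Type} [Fintype V] [DecidableEq V] [Fintype W] [DecidableEq W] {P : SimpleGraph (V ⊕ W)}
      {t : ℕ} {y : Finset (V ⊕ W) → ℝ}, (∀ v w, P.Adj (Sum.inl v) (Sum.inr w)) →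
      IsLasserreFeasible P t y → ∀ zL : {S : Finset V // S ≠ ∅ ∧ S.card ≤ t} → ℝ,
      (∑ S, zL S * y (S.1.map Function.Embedding.inl)) ^ 2 ≤
        ∑ S, ∑ S', zL S * y ((S.1 ∪ S'.1).map Function.Embedding.inl) * zL S' := by
  intro V W _ _ _ _ P t y hP hy zL
  exact lin_sq_le_quad_left hP hy zL

/-! ### The scaled restrictions are feasible -/

omit [Fintype W] in
/-- **Left scaled restriction.** If `p > 0` and `ℓ_L(z)² ≤ p · q_L(z)` for every test vector `z`,
then `S ↦ y(S)/p` (`∅ ↦ 1`) is level-`t` feasible for the left part `P.comap inl`: its moment matrix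
is `[[1, aᵀ/p], [a/p, A/p]]`, whose quadratic form at `(c, z)` is `(p c² + 2c ℓ_L(z) + q_L(z))/p ≥ 0`.
[folklore] -/
theorem isLasserreFeasible_scaledRestrict_left (hy : IsLasserreFeasible P t y) {p : ℝ} (hp : 0 < p)
    (hdom : ∀ z : {S : Finset V // S ≠ ∅ ∧ S.card ≤ t} → ℝ,
      (∑ S, z S * y (S.1.map Function.Embedding.inl)) ^ 2 ≤
        p * ∑ S, ∑ S', z S * y ((S.1 ∪ S'.1).map Function.Embedding.inl) * z S') :
    IsLasserreFeasible (P.comap (Function.Embedding.inl : V ↪ V ⊕ W)) t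
      (fun S : Finset V => if S = ∅ then 1 else y (S.map Function.Embedding.inl) / p) := by
  refine ⟨by simp, ?_, ?_⟩
  · intro u v huv
    have hne : ({u, v} : Finset V) ≠ ∅ := (insert_nonempty u {v}).ne_empty
    have hmap : ({u, v} : Finset V).map Function.Embedding.inl = ({Sum.inl u, Sum.inl v} : Finset (V ⊕ W)) := by
      simp [map_insert]
    have h0 : y ({Sum.inl u, Sum.inl v} : Finset (V ⊕ W)) = 0 := hy.pair_eq_zero huv
    rw [if_neg hne, hmap, h0, zero_div]
  · refine PosSemidef.of_dotProduct_mulVec_nonneg ?_ fun x => ?_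
    · ext I J
      simp only [conjTranspose_apply, star_trivial, momentMatrix_apply, union_comm]
    · rw [star_trivial, quadForm_eq_sum]
      -- reindex `P_t(V)` by `Unit ⊕ {S // S ≠ ∅ ∧ |S| ≤ t}`
      let eV : Unit ⊕ {S : Finset V // S ≠ ∅ ∧ S.card ≤ t} ≃ {S : Finset V // S.card ≤ t} :=
        { toFun := Sum.elim (fun _ => ⟨∅, by simp⟩) (fun S => ⟨S.1, S.2.2⟩)
          invFun := fun I => if h : I.1 = ∅ then Sum.inl () else Sum.inr ⟨I.1, h, I.2⟩
          left_inv := by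
            rintro (u | S)
            · simp
            · simp [S.2.1]
          right_inv := by
            intro I
            by_cases h : I.1 = ∅
            · simp only [h, ↓reduceDIte, Sum.elim_inl]
              exact Subtype.ext h.symm
            · simp [h] }
      have hre : ∑ I, ∑ J, x I * momentMatrix t
            (fun S : Finset V => if S = ∅ then 1 else y (S.map Function.Embedding.inl) / p) I J * x J
          = ∑ i, ∑ j, x (eV i) * momentMatrix t
            (fun S : Finset V => if S = ∅ then 1 else y (S.map Function.Embedding.inl) / p)
              (eV i) (eV j) * x (eV j) := by
        rw [← Equiv.sum_comp eV]
        exact sum_congr rfl fun i _ => by rw [← Equiv.sum_comp eV]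
      rw [hre]
      have hite1 : ∀ S : {S : Finset V // S ≠ ∅ ∧ S.card ≤ t},
          (if (S.1 : Finset V) = ∅ then (1 : ℝ) else y (S.1.map Function.Embedding.inl) / p)
            = y (S.1.map Function.Embedding.inl) / p := fun S => if_neg S.2.1
      have hite2 : ∀ S S' : {S : Finset V // S ≠ ∅ ∧ S.card ≤ t},
          (if (S.1 ∪ S'.1 : Finset V) = ∅ then (1 : ℝ) else y ((S.1 ∪ S'.1).map Function.Embedding.inl) / p)
            = y ((S.1 ∪ S'.1).map Function.Embedding.inl) / p :=
        fun S S' => if_neg (by rw [union_eq_empty]; exact fun h => S.2.1 h.1)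
      simp only [Fintype.sum_sum_type, Finset.univ_unique, Finset.sum_singleton, eV, Equiv.coe_fn_mk,
        Sum.elim_inl, Sum.elim_inr, momentMatrix_apply, empty_union, union_empty, ↓reduceIte,
        hite1, hite2]
      -- collect: `c² + 2c ℓ/p + q/p`
      set c := x ⟨∅, by simp⟩ with hc
      have h1 : ∑ b : {S : Finset V // S ≠ ∅ ∧ S.card ≤ t},
          c * (y (b.1.map Function.Embedding.inl) / p) * x ⟨b.1, b.2.2⟩
            = (c / p) * ∑ b : {S : Finset V // S ≠ ∅ ∧ S.card ≤ t}, x ⟨b.1, b.2.2⟩ * y (b.1.map Function.Embedding.inl) := by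
        rw [Finset.mul_sum]; exact sum_congr rfl fun b _ => by ring
      have h2 : ∑ b : {S : Finset V // S ≠ ∅ ∧ S.card ≤ t},
          (x ⟨b.1, b.2.2⟩ * (y (b.1.map Function.Embedding.inl) / p) * c +
            ∑ b' : {S : Finset V // S ≠ ∅ ∧ S.card ≤ t},
              x ⟨b.1, b.2.2⟩ * (y ((b.1 ∪ b'.1).map Function.Embedding.inl) / p) * x ⟨b'.1, b'.2.2⟩)
          = (c / p) * ∑ b : {S : Finset V // S ≠ ∅ ∧ S.card ≤ t}, x ⟨b.1, b.2.2⟩ * y (b.1.map Function.Embedding.inl) +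
            (1 / p) * ∑ b : {S : Finset V // S ≠ ∅ ∧ S.card ≤ t}, ∑ b' : {S : Finset V // S ≠ ∅ ∧ S.card ≤ t},
              x ⟨b.1, b.2.2⟩ * y ((b.1 ∪ b'.1).map Function.Embedding.inl) * x ⟨b'.1, b'.2.2⟩ := by
        rw [Finset.sum_add_distrib, Finset.mul_sum, Finset.mul_sum]
        congr 1
        · exact sum_congr rfl fun b _ => by ring
        · refine sum_congr rfl fun b _ => ?_
          rw [Finset.mul_sum]
          exact sum_congr rfl fun b' _ => by ring
      rw [h1, h2]
      set l := ∑ b : {S : Finset V // S ≠ ∅ ∧ S.card ≤ t}, x ⟨b.1, b.2.2⟩ * y (b.1.map Function.Embedding.inl) with hl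
      set q := ∑ b : {S : Finset V // S ≠ ∅ ∧ S.card ≤ t}, ∑ b' : {S : Finset V // S ≠ ∅ ∧ S.card ≤ t},
        x ⟨b.1, b.2.2⟩ * y ((b.1 ∪ b'.1).map Function.Embedding.inl) * x ⟨b'.1, b'.2.2⟩ with hq
      have hd : l ^ 2 ≤ p * q := hdom (fun b => x ⟨b.1, b.2.2⟩)
      have hkey : 0 ≤ p * c ^ 2 + 2 * c * l + q := by nlinarith [sq_nonneg (p * c + l), hd, hp]
      have hE : c * 1 * c + c / p * l + (c / p * l + 1 / p * q) = (p * c ^ 2 + 2 * c * l + q) / p := by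
        field_simp
        ring
      rw [hE]
      exact div_nonneg hkey hp.le

omit [Fintype V] in
/-- **Right scaled restriction** (mirror image of `isLasserreFeasible_scaledRestrict_left`).
[folklore] -/
theorem isLasserreFeasible_scaledRestrict_right (hy : IsLasserreFeasible P t y) {p : ℝ} (hp : 0 < p)
    (hdom : ∀ z : {T : Finset W // T ≠ ∅ ∧ T.card ≤ t} → ℝ,
      (∑ T, z T * y (T.1.map Function.Embedding.inr)) ^ 2 ≤
        p * ∑ T, ∑ T', z T * y ((T.1 ∪ T'.1).map Function.Embedding.inr) * z T') :
    IsLasserreFeasible (P.comap (Function.Embedding.inr : W ↪ V ⊕ W)) t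
      (fun T : Finset W => if T = ∅ then 1 else y (T.map Function.Embedding.inr) / p) := by
  refine ⟨by simp, ?_, ?_⟩
  · intro u v huv
    have hne : ({u, v} : Finset W) ≠ ∅ := (insert_nonempty u {v}).ne_empty
    have hmap : ({u, v} : Finset W).map Function.Embedding.inr = ({Sum.inr u, Sum.inr v} : Finset (V ⊕ W)) := by
      simp [map_insert]
    have h0 : y ({Sum.inr u, Sum.inr v} : Finset (V ⊕ W)) = 0 := hy.pair_eq_zero huv
    rw [if_neg hne, hmap, h0, zero_div]
  · refine PosSemidef.of_dotProduct_mulVec_nonneg ?_ fun x => ?_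
    · ext I J
      simp only [conjTranspose_apply, star_trivial, momentMatrix_apply, union_comm]
    · rw [star_trivial, quadForm_eq_sum]
      let eW : Unit ⊕ {T : Finset W // T ≠ ∅ ∧ T.card ≤ t} ≃ {T : Finset W // T.card ≤ t} :=
        { toFun := Sum.elim (fun _ => ⟨∅, by simp⟩) (fun T => ⟨T.1, T.2.2⟩)
          invFun := fun I => if h : I.1 = ∅ then Sum.inl () else Sum.inr ⟨I.1, h, I.2⟩
          left_inv := by
            rintro (u | T)
            · simp
            · simp [T.2.1]
          right_inv := by
            intro I
            by_cases h : I.1 = ∅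
            · simp only [h, ↓reduceDIte, Sum.elim_inl]
              exact Subtype.ext h.symm
            · simp [h] }
      have hre : ∑ I, ∑ J, x I * momentMatrix t
            (fun T : Finset W => if T = ∅ then 1 else y (T.map Function.Embedding.inr) / p) I J * x J
          = ∑ i, ∑ j, x (eW i) * momentMatrix t
            (fun T : Finset W => if T = ∅ then 1 else y (T.map Function.Embedding.inr) / p)
              (eW i) (eW j) * x (eW j) := by
        rw [← Equiv.sum_comp eW]
        exact sum_congr rfl fun i _ => by rw [← Equiv.sum_comp eW]
      rw [hre]
      have hite1 : ∀ T : {T : Finset W // T ≠ ∅ ∧ T.card ≤ t},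
          (if (T.1 : Finset W) = ∅ then (1 : ℝ) else y (T.1.map Function.Embedding.inr) / p)
            = y (T.1.map Function.Embedding.inr) / p := fun T => if_neg T.2.1
      have hite2 : ∀ T T' : {T : Finset W // T ≠ ∅ ∧ T.card ≤ t},
          (if (T.1 ∪ T'.1 : Finset W) = ∅ then (1 : ℝ) else y ((T.1 ∪ T'.1).map Function.Embedding.inr) / p)
            = y ((T.1 ∪ T'.1).map Function.Embedding.inr) / p :=
        fun T T' => if_neg (by rw [union_eq_empty]; exact fun h => T.2.1 h.1)
      simp only [Fintype.sum_sum_type, Finset.univ_unique, Finset.sum_singleton, eW, Equiv.coe_fn_mk,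
        Sum.elim_inl, Sum.elim_inr, momentMatrix_apply, empty_union, union_empty, ↓reduceIte,
        hite1, hite2]
      set c := x ⟨∅, by simp⟩ with hc
      have h1 : ∑ b : {T : Finset W // T ≠ ∅ ∧ T.card ≤ t},
          c * (y (b.1.map Function.Embedding.inr) / p) * x ⟨b.1, b.2.2⟩
            = (c / p) * ∑ b : {T : Finset W // T ≠ ∅ ∧ T.card ≤ t}, x ⟨b.1, b.2.2⟩ * y (b.1.map Function.Embedding.inr) := by
        rw [Finset.mul_sum]; exact sum_congr rfl fun b _ => by ring
      have h2 : ∑ b : {T : Finset W // T ≠ ∅ ∧ T.card ≤ t},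
          (x ⟨b.1, b.2.2⟩ * (y (b.1.map Function.Embedding.inr) / p) * c +
            ∑ b' : {T : Finset W // T ≠ ∅ ∧ T.card ≤ t},
              x ⟨b.1, b.2.2⟩ * (y ((b.1 ∪ b'.1).map Function.Embedding.inr) / p) * x ⟨b'.1, b'.2.2⟩)
          = (c / p) * ∑ b : {T : Finset W // T ≠ ∅ ∧ T.card ≤ t}, x ⟨b.1, b.2.2⟩ * y (b.1.map Function.Embedding.inr) +
            (1 / p) * ∑ b : {T : Finset W // T ≠ ∅ ∧ T.card ≤ t}, ∑ b' : {T : Finset W // T ≠ ∅ ∧ T.card ≤ t},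
              x ⟨b.1, b.2.2⟩ * y ((b.1 ∪ b'.1).map Function.Embedding.inr) * x ⟨b'.1, b'.2.2⟩ := by
        rw [Finset.sum_add_distrib, Finset.mul_sum, Finset.mul_sum]
        congr 1
        · exact sum_congr rfl fun b _ => by ring
        · refine sum_congr rfl fun b _ => ?_
          rw [Finset.mul_sum]
          exact sum_congr rfl fun b' _ => by ring
      rw [h1, h2]
      set l := ∑ b : {T : Finset W // T ≠ ∅ ∧ T.card ≤ t}, x ⟨b.1, b.2.2⟩ * y (b.1.map Function.Embedding.inr) with hl
      set q := ∑ b : {T : Finset W // T ≠ ∅ ∧ T.card ≤ t}, ∑ b' : {T : Finset W // T ≠ ∅ ∧ T.card ≤ t},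
        x ⟨b.1, b.2.2⟩ * y ((b.1 ∪ b'.1).map Function.Embedding.inr) * x ⟨b'.1, b'.2.2⟩ with hq
      have hd : l ^ 2 ≤ p * q := hdom (fun b => x ⟨b.1, b.2.2⟩)
      have hkey : 0 ≤ p * c ^ 2 + 2 * c * l + q := by nlinarith [sq_nonneg (p * c + l), hd, hp]
      have hE : c * 1 * c + c / p * l + (c / p * l + 1 / p * q) = (p * c ^ 2 + 2 * c * l + q) / p := by
        field_simp
        ring
      rw [hE]
      exact div_nonneg hkey hp.le

end Join

end Summit.PneNP.PneNP.Theorems.SosUncertainty
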